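import Literature.NumberTheory.GaloisRepresentations.HeckeCharacterExtensionQuadraticArchProofs
import HarnessLib

/-!
# Extension of finite-order idele class characters along a CM quadratic extension with prescribed
# unramifiedness (special case of Hewitt–Ross (24.12), by Weil's method)

Topic `NumberTheory/GaloisRepresentations`; namespace
`Literature.NumberTheory.GaloisRepresentations.HeckeCharacter`.  Proof file (theorems only), third of
three (`…WeilProofs`, `…ArchProofs`, `…CMProofs`).

`HeckeCharacter.exists_extension_quadratic_of_isTotallyComplex_of_isFiniteOrder`: for `K/F₀` quadratic
with non-trivial automorphism `c`, `F₀` totally real, `K` totally complex, `χ₀` a FINITE-ORDER Hecke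
character of `F₀` and `U` a set of finite places of `K`, `c`-admissible for `χ₀` (`χ₀` unramified below `u`
whenever `u, c • u ∈ U`), there is a unitary Hecke character `χ` of `K` with `χ ∘ BC = χ₀` on `𝕀_{F₀}`,
unramified on `U`.  This is the special case of the named fact
`HewittRoss_heckeCharacter_extension_quadratic` (whose docstring records that this is the only case its
consumer, the crux `QuadraticWindow.HostInducedRep`, uses) — proved here without the duality theorem for
locally compact abelian groups: Weil's open-subgroup/Baer extension (`exists_extension_of_key`) applied to
`V = 𝕌_K ∩ W_𝔣`, `𝔣` supported above the ramified places of `χ₀` and off `U`, and the archimedean character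
`Φ_m` of the right parities; the obstruction — the values `χ₀(a) Φ(y_∞)` on principal `(k) = a_K y` — is a
character of the finite cyclic group of the roots of unity `k / c k` (CM!), killed by one even shift of the
exponent at a chosen infinite place.  The general case (arbitrary quadratic `K/F₀`, arbitrary unitary `χ₀`)
still needs Pontryagin–Hewitt–Ross (or Chevalley's congruence theorem for the relative units) and is NOT
proved here.

## References

* A. Weil, *On a certain type of characters of the idèle-class group of an algebraic number-field*,
  Proc. Int. Symp. Tokyo–Nikko 1955 (1956), 1–7, §1. [Weil1956]
* E. Hewitt, K. A. Ross, *Abstract Harmonic Analysis* I, Grundlehren 115 (1979), Thm. (24.12). [HewittRoss1979]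
-/

noncomputable section

open scoped NumberField Topology
open NumberField IsDedekindDomain Filter
open Literature.NumberTheory.Automorphic

namespace Literature.NumberTheory.GaloisRepresentations

namespace HeckeCharacter

variable {F₀ K : Type} [Field F₀] [NumberField F₀] [Field K] [NumberField K] [Algebra F₀ K]

/-! ### §7. The extension theorem in the CM situation -/

namespace CMQuadraticExtension

/-- `(u/|u|)^m |u|^{0·i} = (u/|u|)^m`. [folklore] -/
theorem archUnitaryValue_zero_right (m : ℤ) (u : ℂ) : archUnitaryValue m 0 u = (u / (‖u‖ : ℂ)) ^ m := by
  unfold archUnitaryValue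
  rw [Complex.ofReal_zero, zero_mul, Complex.cpow_zero, mul_one]

/-- `(u/|u|)² = u / ū` for `u ≠ 0`. [folklore] -/
theorem div_norm_sq_eq_div_conj {u : ℂ} (hu : u ≠ 0) :
    (u / (‖u‖ : ℂ)) ^ 2 = u / starRingEnd ℂ u := by
  have h1 : ((‖u‖ : ℂ)) ^ 2 = u * starRingEnd ℂ u := by
    rw [Complex.mul_conj, Complex.normSq_eq_norm_sq, Complex.ofReal_pow]
  have hc : starRingEnd ℂ u ≠ 0 := (map_ne_zero _).mpr hu
  rw [div_pow, h1, pow_two, mul_div_mul_left _ _ hu]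

end CMQuadraticExtension

open CMQuadraticExtension in
/-- **Extension of finite-order idele class characters along a CM quadratic extension, with
prescribed unramifiedness** — the special case of `HewittRoss_heckeCharacter_extension_quadratic`
in which `F₀` is totally real, `K` is totally complex and `χ₀` has finite order, proved WITHOUT
Pontryagin duality.  For `K/F₀` quadratic with non-trivial automorphism `c`, `F₀` totally real, `K`
totally complex, `χ₀` a Hecke character of `F₀` of finite order and `U` a set of finite places of `K`
such that `χ₀` is unramified below `u` whenever `u, c • u ∈ U`: there is a unitary Hecke character
`χ` of `K` with `χ ∘ BC = χ₀` on `𝕀_{F₀}` which is unramified at every place of `U`.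
Proof (Weil's method, `exists_extension_of_key`): on `BC(𝕀_{F₀}) · V`, `V = 𝕌_K ∩ W_𝔣` for a modulus
`𝔣` supported above the ramified places of `χ₀` and off `U`, put `a_K y ↦ χ₀(a) Φ(y_∞)` with
`Φ = Φ_m` the unitary archimedean character whose parities are those of `χ₀` (`archChar_baseChange_eq`);
a principal idele `(k) = a_K y` in this subgroup has `k / c k` a root of unity
(`pow_torsionOrder_eq_one_of_triple`), the values `χ₀(a) Φ(y_∞)` on such triples form a character of
the finite cyclic group of these roots of unity (they are `1` when `c k = k`, `key_of_mem_range`), and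
the one free even shift `2j` of the exponent `m_{w₀}` at a chosen place multiplies this character by
`ι_{w₀}(k / c k)^j`, so that some `j` kills it. [cite: Weil1956, §1] [cite: HewittRoss1979, Thm. (24.12)] -/
theorem exists_extension_quadratic_of_isTotallyComplex_of_isFiniteOrder
    (F₀ K : Type) [Field F₀] [NumberField F₀] [Field K] [NumberField K] [Algebra F₀ K]
    (c : K ≃ₐ[F₀] K) (h2 : Module.finrank F₀ K = 2) (hc : c ≠ 1)
    (hTR : IsTotallyReal F₀) (hTC : IsTotallyComplex K)
    (χ₀ : HeckeCharacter F₀) (hχ : χ₀.IsFiniteOrder)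
    (U : Set (HeightOneSpectrum (𝓞 K)))
    (hU : ∀ u ∈ U, c • u ∈ U → χ₀.IsUnramifiedAt (u.under (𝓞 F₀))) :
    ∃ χ : HeckeCharacter K, χ.IsUnitary ∧
      (∀ x, χ (AdeleRing.ideleBaseChange F₀ K x) = χ₀ x) ∧ ∀ u ∈ U, χ.IsUnramifiedAt u := by
  classical
  set BC := AdeleRing.ideleBaseChange F₀ K with hBC
  haveI := isGalois (F₀ := F₀) (K := K) h2
  -- STEP 1: a module of definition of `χ₀` supported on its ramified places
  set T₀ : Finset (HeightOneSpectrum (𝓞 F₀)) := (HeckeCharacter.finite_ramifiedPlaces_holds χ₀).toFinset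
    with hT₀
  obtain ⟨e₀, hmod⟩ := HeckeCharacter.exists_isModulus_of_ramified χ₀
  have hT₀mem : ∀ v, v ∈ T₀ ↔ ¬ χ₀.IsUnramifiedAt v := fun v => by
    rw [hT₀, Set.Finite.mem_toFinset]; rfl
  -- STEP 2: the finite set `S` of places above `T₀` and outside `U`, the exponents `E`
  have hfinT : {u : HeightOneSpectrum (𝓞 K) | u.under (𝓞 F₀) ∈ T₀}.Finite := by
    have ht := HeightOneSpectrum.tendsto_under_cofinite (𝓞 F₀) (B := 𝓞 K)
    have := ht (T₀.finite_toSet.compl_mem_cofinite)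
    rw [Filter.mem_map, Filter.mem_cofinite, Set.preimage_compl, compl_compl] at this
    exact this
  set S : Finset (HeightOneSpectrum (𝓞 K)) := (hfinT.subset (fun u (hu : u.under (𝓞 F₀) ∈ T₀ ∧ u ∉ U) =>
    hu.1) : {u | u.under (𝓞 F₀) ∈ T₀ ∧ u ∉ U}.Finite).toFinset with hSdef
  have hSmem : ∀ u, u ∈ S ↔ u.under (𝓞 F₀) ∈ T₀ ∧ u ∉ U := fun u => by
    rw [hSdef, Set.Finite.mem_toFinset]; rfl
  have hSU : ∀ u ∈ U, u ∉ S := fun u hu h => ((hSmem u).mp h).2 hu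
  have hS : ∀ v ∈ T₀, ∃ u ∈ S, u.under (𝓞 F₀) = v := by
    intro v hv
    obtain ⟨u₀, hu₀⟩ := HeightOneSpectrum.under_surjective (A := 𝓞 F₀) (B := 𝓞 K) v
    replace hu₀ : u₀.under (𝓞 F₀) = v := hu₀
    by_cases h₁ : u₀ ∈ U
    · by_cases h₂ : c • u₀ ∈ U
      · exact absurd (hu₀ ▸ hU u₀ h₁ h₂) ((hT₀mem v).mp hv)
      · have hcu : (c • u₀).under (𝓞 F₀) = v := by
          rw [HeightOneSpectrum.under_algEquiv_smul]; exact hu₀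
        exact ⟨c • u₀, (hSmem _).mpr ⟨by rw [hcu]; exact hv, h₂⟩, hcu⟩
    · exact ⟨u₀, (hSmem _).mpr ⟨by rw [hu₀]; exact hv, h₁⟩, hu₀⟩
  set E : HeightOneSpectrum (𝓞 K) → ℕ := fun u =>
    e₀ (u.under (𝓞 F₀)) * (u.under (𝓞 F₀)).asIdeal.ramificationIdx' u.asIdeal with hE
  set V : Subgroup (ideleGroup K) := unitIdeles K ⊓ congruenceIdeles (modulusIdeal S E) with hV
  have hVnhds : (V : Set (ideleGroup K)) ∈ 𝓝 (1 : ideleGroup K) := nbhd_mem_nhds_one S E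
  have hβ : ∀ b : ideleGroup F₀, (b : AdeleRing (𝓞 F₀) F₀).1 = 1 → BC b ∈ V → χ₀ b = 1 :=
    fun b hb1 hbV => map_eq_one_of_baseChange_mem_nbhd χ₀ S E hmod hS (fun u _ => le_rfl) b hb1 hbV
  -- STEP 3: the parities `b v` of `χ₀` at the real places
  have hb' : ∀ v : InfinitePlace F₀, ∃ n : ℕ, ∀ e : (InfiniteAdeleRing F₀)ˣ, (e : InfiniteAdeleRing F₀) v = -1 →
      (∀ v', v' ≠ v → (e : InfiniteAdeleRing F₀) v' = 1) → (χ₀ (infiniteIdeles F₀ e) : ℂ) = (-1) ^ n := by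
    intro v
    -- the sign idele at `v`
    let e₀ : (InfiniteAdeleRing F₀)ˣ :=
      ⟨fun v' => if v' = v then -1 else 1, fun v' => if v' = v then -1 else 1,
        funext fun v' => by
          change (if v' = v then (-1 : v'.Completion) else 1) * (if v' = v then (-1 : v'.Completion) else 1) = 1
          split_ifs <;> simp,
        funext fun v' => by
          change (if v' = v then (-1 : v'.Completion) else 1) * (if v' = v then (-1 : v'.Completion) else 1) = 1
          split_ifs <;> simp⟩
    have he₀ : e₀ * e₀ = 1 := Units.ext e₀.val_inv
    have hsq : ((χ₀ (infiniteIdeles F₀ e₀) : ℂ)) ^ 2 = 1 := by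
      rw [pow_two, ← Units.val_mul, ← map_mul, ← map_mul, he₀, map_one, map_one, Units.val_one]
    have huniq : ∀ e : (InfiniteAdeleRing F₀)ˣ, (e : InfiniteAdeleRing F₀) v = -1 →
        (∀ v', v' ≠ v → (e : InfiniteAdeleRing F₀) v' = 1) → e = e₀ := by
      intro e he he'
      apply Units.ext; funext v'
      change (e : InfiniteAdeleRing F₀) v' = if v' = v then -1 else 1
      by_cases h : v' = v
      · subst h; rw [if_pos rfl, he]
      · rw [if_neg h, he' v' h]
    rcases sq_eq_one_iff.mp hsq with h | h
    · exact ⟨0, fun e he he' => by rw [huniq e he he', h, pow_zero]⟩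
    · exact ⟨1, fun e he he' => by rw [huniq e he he', h, pow_one]⟩
  choose b hb using hb'
  -- STEP 4: the archimedean characters `Φ_j`, `j ∈ ℤ` (even shift at the chosen place `w₀`)
  obtain ⟨w₀⟩ : Nonempty (InfinitePlace K) := inferInstance
  set m : ℤ → InfinitePlace K → ℤ := fun j w =>
    (b (w.comap (algebraMap F₀ K)) : ℤ) + 2 * (if w = w₀ then j else 0) with hm
  have hmpar : ∀ j w, ∃ i : ℤ, m j w = b (w.comap (algebraMap F₀ K)) + 2 * i := fun j w => ⟨_, rfl⟩
  choose Φ hΦ using fun j : ℤ => exists_continuousMonoidHom_archUnitaryValue (K := K) (m j) (fun _ => 0)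
  have hι0 : ∀ (z : (InfiniteAdeleRing K)ˣ) (w : InfinitePlace K),
      InfinitePlace.Completion.extensionEmbedding w ((z : InfiniteAdeleRing K) w) ≠ 0 :=
    fun z w => InfiniteIdele.extensionEmbedding_apply_ne_zero z w
  have hΦunit : ∀ j z, ‖(Φ j z : ℂ)‖ = 1 := fun j z => by
    rw [hΦ, norm_prod]
    exact Finset.prod_eq_one fun w _ => norm_archUnitaryValue (hι0 z w) _ _
  have hα : ∀ j (x : (InfiniteAdeleRing F₀)ˣ),
      (Φ j (HeckeCharacter.infPart K (BC (infiniteIdeles F₀ x))) : ℂ) = χ₀ (infiniteIdeles F₀ x) :=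
    fun j x => archChar_baseChange_eq χ₀ c h2 hc hTR hTC hχ b hb (m j) (hmpar j) (Φ j) (hΦ j) x
  -- the shift formula: `Φ_j(z) = Φ_0(z) · ((u/|u|)²)^j`, `u = ι_{w₀}(z_{w₀})`
  have hshift : ∀ j (z : (InfiniteAdeleRing K)ˣ), (Φ j z : ℂ) = (Φ 0 z : ℂ) *
      ((InfinitePlace.Completion.extensionEmbedding w₀ ((z : InfiniteAdeleRing K) w₀) /
        (‖InfinitePlace.Completion.extensionEmbedding w₀ ((z : InfiniteAdeleRing K) w₀)‖ : ℂ)) ^ 2) ^ j := by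
    intro j z
    rw [hΦ, hΦ]
    have hne : ∀ w, InfinitePlace.Completion.extensionEmbedding w ((z : InfiniteAdeleRing K) w) /
        (‖InfinitePlace.Completion.extensionEmbedding w ((z : InfiniteAdeleRing K) w)‖ : ℂ) ≠ 0 := fun w =>
      div_ne_zero (hι0 z w) (by exact_mod_cast norm_ne_zero_iff.mpr (hι0 z w))
    have key : ∀ w, archUnitaryValue (m j w) 0
        (InfinitePlace.Completion.extensionEmbedding w ((z : InfiniteAdeleRing K) w)) =
        archUnitaryValue (m 0 w) 0 (InfinitePlace.Completion.extensionEmbedding w ((z : InfiniteAdeleRing K) w)) *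
          (((InfinitePlace.Completion.extensionEmbedding w ((z : InfiniteAdeleRing K) w) /
            (‖InfinitePlace.Completion.extensionEmbedding w ((z : InfiniteAdeleRing K) w)‖ : ℂ)) ^ 2) ^
            (if w = w₀ then j else 0)) := by
      intro w
      rw [archUnitaryValue_zero_right, archUnitaryValue_zero_right]
      change _ ^ ((b (w.comap (algebraMap F₀ K)) : ℤ) + 2 * (if w = w₀ then j else 0)) =
        _ ^ ((b (w.comap (algebraMap F₀ K)) : ℤ) + 2 * (if w = w₀ then (0 : ℤ) else 0)) * _
      rw [ite_self, mul_zero, add_zero, zpow_add₀ (hne w), zpow_mul, zpow_ofNat]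
    rw [Finset.prod_congr rfl (fun w _ => key w), Finset.prod_mul_distrib]
    congr 1
    rw [Finset.prod_eq_single w₀ (fun w _ hw => by rw [if_neg hw, zpow_zero])
      (fun h => absurd (Finset.mem_univ w₀) h), if_pos rfl]
  -- STEP 5: the admissible triples and the root of unity `k / c k`
  set cK : Kˣ →* Kˣ := Units.map (c : K →+* K).toMonoidHom with hcK
  let G := ideleGroup F₀ × ideleGroup K × Kˣ
  set Ssub : Subgroup G :=
    { carrier := {t | t.2.1 ∈ V ∧ BC t.1 * t.2.1 = principalIdele K t.2.2}
      one_mem' := ⟨V.one_mem, by simp [map_one]⟩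
      mul_mem' := fun {t t'} ht ht' => ⟨V.mul_mem ht.1 ht'.1, by
        change BC (t.1 * t'.1) * (t.2.1 * t'.2.1) = principalIdele K (t.2.2 * t'.2.2)
        rw [map_mul, map_mul, ← ht.2, ← ht'.2, mul_mul_mul_comm]⟩
      inv_mem' := fun {t} ht => ⟨V.inv_mem ht.1, by
        change BC t.1⁻¹ * t.2.1⁻¹ = principalIdele K t.2.2⁻¹
        rw [map_inv, map_inv, ← ht.2, mul_inv]⟩ } with hSsub
  have hSmem' : ∀ t : G, t ∈ Ssub ↔ t.2.1 ∈ V ∧ BC t.1 * t.2.1 = principalIdele K t.2.2 := fun t => Iff.rfl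
  set ρ : G →* Kˣ :=
    { toFun := fun t => t.2.2 * (cK t.2.2)⁻¹
      map_one' := by simp
      map_mul' := fun t t' => by
        change (t.2.2 * t'.2.2) * (cK (t.2.2 * t'.2.2))⁻¹ = (t.2.2 * (cK t.2.2)⁻¹) * (t'.2.2 * (cK t'.2.2)⁻¹)
        rw [map_mul, mul_inv, mul_mul_mul_comm] } with hρ
  have hρ_apply : ∀ t : G, ρ t = t.2.2 * (cK t.2.2)⁻¹ := fun t => rfl
  have hρ_val : ∀ t : G, ((ρ t : Kˣ) : K) = (t.2.2 : K) * (c (t.2.2 : K))⁻¹ := fun t => by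
    rw [hρ_apply, Units.val_mul, Units.val_inv_eq_inv_val]; rfl
  -- (a) torsion
  set N := Units.torsionOrder K with hN
  have hρtors : ∀ t ∈ Ssub, (ρ t) ^ N = 1 := fun t ht =>
    pow_torsionOrder_eq_one_of_triple c h2 hc hTR hTC (V.toSubmonoid.toSubsemigroup.mem_carrier.mp ht.1).1 ht.2
  -- (b) the values `val_j t = χ₀(a) Φ_j(y_∞)` and their triviality when `ρ t = 1`
  set val : ℤ → G →* ℂˣ := fun j =>
    { toFun := fun t => χ₀ t.1 * Φ j (HeckeCharacter.infPart K t.2.1)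
      map_one' := by simp
      map_mul' := fun t t' => by
        change χ₀ (t.1 * t'.1) * Φ j (HeckeCharacter.infPart K (t.2.1 * t'.2.1)) = _
        rw [map_mul, map_mul, map_mul, mul_mul_mul_comm] } with hval
  have hval_apply : ∀ j (t : G), (val j t : ℂ) = (χ₀ t.1 : ℂ) * Φ j (HeckeCharacter.infPart K t.2.1) :=
    fun j t => by rw [hval]; rfl
  have hfixed : ∀ j, ∀ t ∈ Ssub, ρ t = 1 → val j t = 1 := by
    intro j t ht hρt
    obtain ⟨hyV, h⟩ := ht
    -- `c k = k`, so `k ∈ F₀`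
    have hck : c (t.2.2 : K) = t.2.2 := by
      have := congrArg (fun u : Kˣ => (u : K)) hρt
      simp only [hρ_val, Units.val_one] at this
      rw [mul_inv_eq_one₀ ((map_ne_zero c).mpr t.2.2.ne_zero)] at this
      exact this.symm
    obtain ⟨k₀', hk₀'⟩ := exists_algebraMap_eq_of_apply_eq c h2 hc hck
    have hk₀0 : k₀' ≠ 0 := by rintro rfl; exact t.2.2.ne_zero (by rw [← hk₀', map_zero])
    set k₀ : F₀ˣ := Units.mk0 k₀' hk₀0 with hk₀
    have hkk : principalIdele K t.2.2 = BC (principalIdele F₀ k₀) := by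
      rw [← principalIdele_algebraMap]
      congr 1
      exact Units.ext hk₀'.symm
    apply Units.ext
    rw [hval_apply, Units.val_one]
    exact key_of_mem_range S E χ₀ hTC (Φ j) (hα j) hβ k₀ hyV (h.trans hkk)
  -- (c) the shift on admissible triples: `val_j t = val_0 t · φ₀(ρ t)^j`, `φ₀ = w₀.embedding`
  set φ₀ : K →+* ℂ := w₀.embedding with hφ₀
  have hshift' : ∀ j, ∀ t ∈ Ssub, (val j t : ℂ) = (val 0 t : ℂ) * (φ₀ ((ρ t : Kˣ) : K)) ^ j := by
    intro j t ht
    obtain ⟨-, h⟩ := ht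
    rw [hval_apply, hval_apply, hshift j, ← mul_assoc]
    congr 2
    -- the `w₀`-component of `y = (k) · a_K⁻¹`
    set y := t.2.1
    set a := t.1
    set k := t.2.2
    have hy : y = principalIdele K k * (BC a)⁻¹ := by rw [← h, mul_inv_cancel_comm]
    have hreal : (w₀.comap (algebraMap F₀ K)).IsReal := hTR.isReal _
    set r : ℝ := InfinitePlace.Completion.extensionEmbeddingOfIsReal hreal
      ((a : AdeleRing (𝓞 F₀) F₀).1 (w₀.comap (algebraMap F₀ K))) with hr
    have hBCa : InfinitePlace.Completion.extensionEmbedding w₀ (((BC a : ideleGroup K) : AdeleRing (𝓞 K) K).1 w₀)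
        = (r : ℂ) := by
      rw [hBC, AdeleRing.coe_ideleBaseChange, AdeleRing.baseChange_fst, InfiniteAdeleRing.baseChange_apply,
        extensionEmbedding_infiniteCompletionOfComap w₀ hreal]
    have hr0 : (r : ℂ) ≠ 0 := by rw [← hBCa]; exact hι0 (HeckeCharacter.infPart K (BC a)) w₀
    have hu : InfinitePlace.Completion.extensionEmbedding w₀
        (((HeckeCharacter.infPart K y : (InfiniteAdeleRing K)ˣ) : InfiniteAdeleRing K) w₀) =
          φ₀ (k : K) * (r : ℂ)⁻¹ := by
      rw [HeckeCharacter.val_infPart, hy, ideleGroup_val_fst_mul]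
      change InfinitePlace.Completion.extensionEmbedding w₀
        ((principalIdele K k : AdeleRing (𝓞 K) K).1 w₀ * (((BC a)⁻¹ : ideleGroup K) : AdeleRing (𝓞 K) K).1 w₀) = _
      rw [map_mul, ideleGroup_val_inv_fst_apply, map_inv₀, hBCa, principalIdele_fst,
        InfiniteAdeleRing.algebraMap_apply]
      congr 1
      exact InfinitePlace.Completion.extensionEmbedding_coe w₀ _
    rw [hu, div_norm_sq_eq_div_conj (mul_ne_zero ((map_ne_zero φ₀).mpr k.ne_zero) (inv_ne_zero hr0)),
      map_mul, map_inv₀, Complex.conj_ofReal, mul_div_mul_right _ _ (inv_ne_zero hr0), hρ_val,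
      map_mul, map_inv₀, ← apply_conj c h2 hc hTR hTC φ₀, div_eq_mul_inv]
  -- STEP 6: the image of `ρ` is a finite cyclic group; choose `j` killing `val_j` on a generator
  set R : Subgroup Kˣ := Ssub.map ρ with hR
  have hRle : (R : Set Kˣ) ⊆ (rootsOfUnity N K : Set Kˣ) := by
    rintro _ ⟨t, ht, rfl⟩
    exact (mem_rootsOfUnity _ _).mpr (hρtors t ht)
  haveI : NeZero N := ⟨Units.torsionOrder_ne_zero K⟩
  have hfinroots : (rootsOfUnity N K : Set Kˣ).Finite :=
    Set.finite_coe_iff.mp (inferInstance : Finite (rootsOfUnity N K))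
  haveI : Finite R := Set.Finite.to_subtype (hfinroots.subset hRle)
  obtain ⟨g, hg⟩ := IsCyclic.exists_generator (α := R)
  obtain ⟨t₁, ht₁, hgt₁⟩ : ∃ t₁ ∈ Ssub, ρ t₁ = g := Subgroup.mem_map.mp g.2
  set d := orderOf (g : Kˣ) with hd
  have hdpos : 0 < d := orderOf_pos_iff.mpr (isOfFinOrder_iff_pow_eq_one.mpr
    ⟨N, Units.torsionOrder_pos K, (mem_rootsOfUnity _ _).mp (hRle g.2)⟩)
  haveI : NeZero d := ⟨hdpos.ne'⟩
  have hprim : IsPrimitiveRoot (φ₀ ((g : Kˣ) : K)) d := by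
    have h1 : IsPrimitiveRoot (g : Kˣ) d := IsPrimitiveRoot.orderOf _
    have h2' : IsPrimitiveRoot ((g : Kˣ) : K) d := (IsPrimitiveRoot.coe_units_iff).mpr h1
    exact h2'.map_of_injective φ₀.injective
  -- `val_0 t₁` is a `d`-th root of unity
  have hξ : ((val 0 t₁ : ℂˣ) : ℂ) ^ d = 1 := by
    have ht₁d : t₁ ^ d ∈ Ssub := Ssub.pow_mem ht₁ d
    have hρd : ρ (t₁ ^ d) = 1 := by rw [map_pow, hgt₁]; exact pow_orderOf_eq_one (g : Kˣ)
    have := hfixed 0 _ ht₁d hρd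
    rw [map_pow] at this
    rw [← Units.val_pow_eq_pow_val, this, Units.val_one]
  obtain ⟨i, -, hi⟩ := hprim.eq_pow_of_pow_eq_one hξ
  set j : ℤ := -(i : ℤ) with hj
  -- `val_j` kills `t₁`, hence every admissible triple
  have hvalt₁ : val j t₁ = 1 := by
    apply Units.ext
    rw [hshift' j t₁ ht₁, hgt₁, ← hi, Units.val_one, hj, zpow_neg, zpow_natCast, mul_inv_cancel₀]
    exact pow_ne_zero _ (hprim.ne_zero hdpos.ne')
  have hkey : ∀ t ∈ Ssub, val j t = 1 := by
    intro t ht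
    have hmem : ρ t ∈ R := Subgroup.mem_map.mpr ⟨t, ht, rfl⟩
    obtain ⟨n, hn⟩ := Subgroup.mem_zpowers_iff.mp (hg ⟨ρ t, hmem⟩)
    have hn' : (g : Kˣ) ^ n = ρ t := by
      have := congrArg (fun u : R => (u : Kˣ)) hn
      simpa using this
    have ht' : t * (t₁ ^ n)⁻¹ ∈ Ssub := Ssub.mul_mem ht (Ssub.inv_mem (Ssub.zpow_mem ht₁ n))
    have hρ' : ρ (t * (t₁ ^ n)⁻¹) = 1 := by
      rw [map_mul, map_inv, map_zpow, hgt₁, hn', mul_inv_cancel]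
    have := hfixed j _ ht' hρ'
    rwa [map_mul, map_inv, map_zpow, hvalt₁, one_zpow, inv_one, mul_one] at this
  -- STEP 7: Weil's extension principle
  obtain ⟨χ, hχu, hχres, hχV⟩ := exists_extension_of_key χ₀ hχ.isUnitary V hVnhds (Φ j) (hΦunit j)
    (fun a y k hyV h => by
      have := hkey (a, y, k) ⟨hyV, h⟩
      have h' := congrArg (fun u : ℂˣ => (u : ℂ)) this
      simpa only [hval_apply, Units.val_one] using h')
  refine ⟨χ, hχu, hχres, fun u hu ε => ?_⟩
  -- STEP 8: unramifiedness at `u ∈ U`: the local units lie in `V`, where `χ = Φ_j ∘ (·)_∞ = 1`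
  rw [HeckeCharacter.localComponent_apply]
  have hmem := localUnits_mem_nbhd S E (hSU u hu) ε
  apply Units.ext
  rw [hχV _ hmem, Units.val_one]
  have h1 : HeckeCharacter.infPart K (localUnits u (Units.map ((u.adicCompletionIntegers K).subtype : _ →* _) ε)) = 1 := by
    apply Units.ext
    rw [HeckeCharacter.val_infPart, localUnits_fst, Units.val_one]
  rw [h1, map_one, Units.val_one]

end HeckeCharacter

end Literature.NumberTheory.GaloisRepresentations

end
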